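import Summits.HodgeConjecture.HodgeConjecture.Theses.PeriodDeficiency
import Literature.AlgebraicGeometry.HodgeTheory.AlgebraicityLocus
import Literature.AlgebraicGeometry.HodgeTheory.HodgeLocus
import Literature.AlgebraicGeometry.HodgeTheory.GlobalInvariantCycles
import Literature.AlgebraicGeometry.HodgeTheory.FermatHypersurfaceReduction
import Literature.AlgebraicGeometry.HodgeTheory.HodgeConjectureQbarVoisin
import Literature.AlgebraicGeometry.Motives.AtypicalHodgeLocus
import Literature.AlgebraicGeometry.Motives.PeriodRealizationClassical
import Literature.AlgebraicGeometry.Motives.FamiliesVHS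
import Literature.AlgebraicGeometry.Motives.BaseChange
import HarnessLib
import Literature.AlgebraicGeometry.HodgeTheory.HodgeGenericQbarDescent
import Literature.AlgebraicGeometry.HodgeTheory.QbarGenericPointsDense

/-!
# Route PeriodDeficiency — `GenericityReduction` (item stmt-HodgeConjecture-11598), conditional form

The support item `GenericityReduction` of route `HodgeConjecture/PeriodDeficiency` is the known
reduction

  `ClassicalGeometricVHS → QbarGenericIsHodgeGeneric → HodgeConjectureQbar → HodgeModelsExist →
  HodgeConjecture`

("a `ℚ̄`-generic point is Hodge-generic" and the Hodge conjecture over `ℚ̄` give the Hodge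
conjecture; the shape of Charles–Schnell, *Notes on absolute Hodge classes*, Thm. 11.3.19 and of
Voisin, *Hodge loci and absolute Hodge classes*, Prop. 0.7 / arXiv Prop. 1.7).  This file proves it
in Lean from four NAMED FACTS of the printed literature, stated below on the tree's real carriers and
on the route's own vocabulary (`Motives.GeometricVHSData`, `VHSData.IsHodgeGenericIn`):

* `lang1958_isDefinedOverQbar_descends` — Weil's `ℚ̄`-closed sets of complex points of
  `S₀ ⊗_σ ℂ` are the sets of points lying over a Zariski-closed `W ⊆ S₀` (Lang, *Introduction to
  Algebraic Geometry*, III §5, C4 ⇒ C7; the converse is the tree's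
  `isDefinedOverQbar_setOf_base_pt_mem`);
* `spreadingOut_smoothProjective_qbarFamily` — every smooth projective complex variety is the fibre,
  at a complex point lying over the generic point of the base, of the complexification of a smooth
  projective family over a smooth irreducible quasi-projective `ℚ̄`-variety (Charles–Schnell §11.3.5
  and proof of Thm. 11.3.17; Voisin 2007 §3);
* `bku_finite_monodromyOrbit_of_isHodgeGenericIn` — at a Hodge-generic point (Mumford–Tate group of
  maximal dimension, Baldi–Klingler–Ullmo §3.2) every Hodge class has finite monodromy orbit
  (Klingler–Otwinowska–Urbanik §1.1.1: the Hodge locus `HL(S, 𝕍) ⊆ HL(S, 𝕍^⊗)` is the projection of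
  the exceptional classes, those with infinite monodromy orbit);
* `voisin2007_algebraic_of_finite_monodromyOrbit_of_qbar` — for a family defined over `ℚ̄`, a Hodge
  class with finite monodromy orbit is algebraic as soon as the Hodge conjecture holds for smooth
  projective varieties defined over `ℚ̄` (finite étale cover defined over `ℚ̄`, Deligne's global
  invariant cycle theorem on a smooth compactification over `ℚ̄`, restriction; Voisin 2007, proof of
  Prop. 1.7; Charles–Schnell Thm. 11.3.19).

Glue (proved): fix `σ : ℚ̄ →+* ℂ`; spread `X` out, `X ≅ 𝒳_s` with `s` over the generic point of
`S₀`; every `ℚ̄`-closed set through `s` is everything (Lang), so the `ℚ̄`-Zariski closure `W` of `s`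
in `QbarGenericIsHodgeGeneric` is `S(ℂ)` and `s` is Hodge-generic in `S(ℂ)` for the geometric VHS
datum `D` supplied by `ClassicalGeometricVHS`; hence every rational `(p,p)` class on `𝒳_s` has finite
monodromy orbit, hence is algebraic by `HodgeConjectureQbar`; the Hodge-model conjunct is the fourth
hypothesis; finally `HodgeConjectureFor` is transported along `X ≅ 𝒳_s`.
-/

-- every declaration of this problem lives in `Summit.HodgeConjecture.HodgeConjecture.…`
set_option linter.dupNamespace false

noncomputable section

open CategoryTheory AlgebraicGeometry Topology
open Literature.AlgebraicGeometry.Motives Literature.AlgebraicGeometry.HodgeTheory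
open Literature.AlgebraicTopology.SingularHomology

namespace Summit.HodgeConjecture.HodgeConjecture.Theorems

/-! ### The four named facts -/

/-- A `ℚ̄`-closed set of complex points through a point lying over the generic point of the
quasi-projective base `S₀` is everything (granted Lang's C4 ⇒ C7): it is the set of points over a
closed `W ⊆ S₀` containing a dense point. [cite: Lang1958IAG, Ch. III §5] -/
theorem eq_univ_of_isDefinedOverQbar_of_dense (hL : Literature.AlgebraicGeometry.HodgeTheory.lang1958_isDefinedOverQbar_descends)
    (σ : AlgebraicClosure ℚ →+* ℂ) {S₀ : SchemeOver (AlgebraicClosure ℚ)}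
    (hS₀ : IsQuasiProjectiveOver S₀) {s : ComplexPoints ((baseChangeHom σ).obj S₀)}
    (hs : closure {(baseChangeHomFst σ S₀).base s.pt} = (Set.univ : Set S₀.left))
    {Z : Set (ComplexPoints ((baseChangeHom σ).obj S₀))} (hZ : IsDefinedOverQbar σ S₀ Z)
    (hsZ : s ∈ Z) : Z = Set.univ := by
  obtain ⟨W, hWc, rfl⟩ := hL σ S₀ hS₀ Z hZ
  have hW : W = Set.univ := by
    refine Set.eq_univ_of_univ_subset ?_
    rw [← hs]
    exact closure_minimal (Set.singleton_subset_iff.2 hsZ) hWc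
  simp [hW]

/-- **`GenericityReduction` from the four named facts.**  The type of the conclusion is literally the
route decl `Summit.HodgeConjecture.HodgeConjecture.Theses.PeriodDeficiency.GenericityReduction`.
[cite: CharlesSchnell2014Notes, Thm. 11.3.19] [cite: Voisin2007HodgeLoci, Prop. 1.7] -/
theorem genericityReduction_of_facts (hL : Literature.AlgebraicGeometry.HodgeTheory.lang1958_isDefinedOverQbar_descends)
    (hSp : Literature.AlgebraicGeometry.HodgeTheory.spreadingOut_smoothProjective_qbarFamily)
    (hB : Literature.AlgebraicGeometry.HodgeTheory.bku_finite_monodromyOrbit_of_isHodgeGenericIn)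
    (hV : Literature.AlgebraicGeometry.HodgeTheory.voisin2007_algebraic_of_finite_monodromyOrbit_of_qbar) :
    Summit.HodgeConjecture.HodgeConjecture.Theses.PeriodDeficiency.GenericityReduction := by
  unfold Summit.HodgeConjecture.HodgeConjecture.Theses.PeriodDeficiency.GenericityReduction
  intro hC hG hQ hM n X hX
  obtain ⟨σ⟩ := exists_ringHom_algebraicClosure_rat_complex
  obtain ⟨𝒳₀, S₀, f₀, s, h𝒳₀, hS₀, hirr, hsm, hf, hgen, ⟨e⟩⟩ := hSp σ hX
  have hXs : IsSmoothProjective n (fiberOver ((baseChangeHom σ).map f₀) s) :=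
    hf.isSmoothProjective s
  -- the cycle part of the Hodge conjecture for the fibre `𝒳_s`
  have hfib : ∀ (p : ℕ) (α : complexBetti (fiberOver ((baseChangeHom σ).map f₀) s) (2 * p)),
      IsRationalClass α → IsOfHodgeType n (fiberOver ((baseChangeHom σ).map f₀) s) (2 * p) p p α →
        α ∈ algebraicClasses (fiberOver ((baseChangeHom σ).map f₀) s) p := by
    intro p α hαr hαh
    -- the classical Betti–Hodge datum and the geometric VHS datum of `R²ᵖ f_* ℚ`
    obtain ⟨B, hBc, hT, hD⟩ := hC
    haveI : HodgeTensorFacts.{0, 0} := hT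
    obtain ⟨D, hfin⟩ := hD σ f₀ n (2 * p) hf hirr hsm
    haveI : ∀ t, Module.Finite ℚ (D.V.fiber t) := hfin
    -- `s` is Hodge-generic in its `ℚ̄`-Zariski closure, which is everything
    have hHG := hG B hBc σ f₀ n (2 * p) D hirr hsm s
    have hW : (⋂₀ {Z | IsDefinedOverQbar σ S₀ Z ∧ s ∈ Z}) =
        (Set.univ : Set (ComplexPoints ((baseChangeHom σ).obj S₀))) := by
      rw [Set.sInter_eq_univ]
      rintro Z ⟨hZ, hsZ⟩
      exact eq_univ_of_isDefinedOverQbar_of_dense hL σ hS₀ hgen hZ hsZ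
    rw [hW] at hHG
    -- finite monodromy, then `ℚ̄`-descent of algebraicity
    have hfinOrbit := hB B hBc σ f₀ n p D h𝒳₀ hS₀ hirr hsm s hHG α hαr hαh
    exact hV σ f₀ n p h𝒳₀ hS₀ hirr hsm hf s α hαr hαh hfinOrbit
      (fun m X₀ hX₀ q c hc hh ↦ (hQ σ hX₀).2 q c hc hh)
  -- transport along `e : X ≅ 𝒳_s` (Hodge models, rational `(p,p)` classes and algebraic classes
  -- transport along isomorphisms: `HodgeModel.ofIso`, `IsRationalClass.map`,
  -- `IsOfHodgeType.map_of_iso`, `mem_algebraicClasses_map_of_iso`)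
  obtain ⟨A⟩ := hM n _ hXs
  refine ⟨⟨A.ofIso e⟩, fun p c hc hpp ↦ ?_⟩
  have halg := mem_algebraicClasses_map_of_iso hXs hX e
    (hfib p (singularCohomology.map ℂ ℂ (AlgPoints.mapContinuous (L := ℂ) e.inv) (2 * p) c)
      (hc.map _) (hpp.map_of_iso e.symm))
  rwa [show complexBetti.map e.hom (2 * p)
      (singularCohomology.map ℂ ℂ (AlgPoints.mapContinuous (L := ℂ) e.inv) (2 * p) c) = c from
    map_hom_map_inv_apply e (2 * p) c] at halg


/-! ### Three named facts suffice: Lang's C4 ⇒ C7 is replaced by its proved generic-point case -/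

/-- **`GenericityReduction` from a `ℚ̄`-genericity principle and the three Hodge-theoretic /
geometric named facts.**  The only use of Lang's C4 ⇒ C7 (`lang1958_isDefinedOverQbar_descends`)
in `genericityReduction_of_facts` is: a `ℚ̄`-closed set of complex points through a point over the
generic point of the quasi-projective base is everything.  This version takes exactly that
principle as its first hypothesis. [cite: CharlesSchnell2014Notes, Thm. 11.3.19]
[cite: Voisin2007HodgeLoci, Prop. 1.7] -/
theorem genericityReduction_of_qbarGeneric
    (hQg : ∀ (σ : AlgebraicClosure ℚ →+* ℂ) (S₀ : SchemeOver (AlgebraicClosure ℚ)),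
      IsQuasiProjectiveOver S₀ → ∀ (s : ComplexPoints ((baseChangeHom σ).obj S₀)),
        closure {(baseChangeHomFst σ S₀).base s.pt} = (Set.univ : Set S₀.left) →
        ∀ Z : Set (ComplexPoints ((baseChangeHom σ).obj S₀)), IsDefinedOverQbar σ S₀ Z → s ∈ Z →
          Z = Set.univ)
    (hSp : Literature.AlgebraicGeometry.HodgeTheory.spreadingOut_smoothProjective_qbarFamily)
    (hB : Literature.AlgebraicGeometry.HodgeTheory.bku_finite_monodromyOrbit_of_isHodgeGenericIn)
    (hV : Literature.AlgebraicGeometry.HodgeTheory.voisin2007_algebraic_of_finite_monodromyOrbit_of_qbar) :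
    Summit.HodgeConjecture.HodgeConjecture.Theses.PeriodDeficiency.GenericityReduction := by
  unfold Summit.HodgeConjecture.HodgeConjecture.Theses.PeriodDeficiency.GenericityReduction
  intro hC hG hQ hM n X hX
  obtain ⟨σ⟩ := exists_ringHom_algebraicClosure_rat_complex
  obtain ⟨𝒳₀, S₀, f₀, s, h𝒳₀, hS₀, hirr, hsm, hf, hgen, ⟨e⟩⟩ := hSp σ hX
  have hXs : IsSmoothProjective n (fiberOver ((baseChangeHom σ).map f₀) s) :=
    hf.isSmoothProjective s
  -- the cycle part of the Hodge conjecture for the fibre `𝒳_s`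
  have hfib : ∀ (p : ℕ) (α : complexBetti (fiberOver ((baseChangeHom σ).map f₀) s) (2 * p)),
      IsRationalClass α → IsOfHodgeType n (fiberOver ((baseChangeHom σ).map f₀) s) (2 * p) p p α →
        α ∈ algebraicClasses (fiberOver ((baseChangeHom σ).map f₀) s) p := by
    intro p α hαr hαh
    obtain ⟨B, hBc, hT, hD⟩ := hC
    haveI : HodgeTensorFacts.{0, 0} := hT
    obtain ⟨D, hfin⟩ := hD σ f₀ n (2 * p) hf hirr hsm
    haveI : ∀ t, Module.Finite ℚ (D.V.fiber t) := hfin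
    have hHG := hG B hBc σ f₀ n (2 * p) D hirr hsm s
    have hW : (⋂₀ {Z | IsDefinedOverQbar σ S₀ Z ∧ s ∈ Z}) =
        (Set.univ : Set (ComplexPoints ((baseChangeHom σ).obj S₀))) := by
      rw [Set.sInter_eq_univ]
      rintro Z ⟨hZ, hsZ⟩
      exact hQg σ S₀ hS₀ s hgen Z hZ hsZ
    rw [hW] at hHG
    have hfinOrbit := hB B hBc σ f₀ n p D h𝒳₀ hS₀ hirr hsm s hHG α hαr hαh
    exact hV σ f₀ n p h𝒳₀ hS₀ hirr hsm hf s α hαr hαh hfinOrbit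
      (fun m X₀ hX₀ q c hc hh ↦ (hQ σ hX₀).2 q c hc hh)
  -- transport along `e : X ≅ 𝒳_s`
  obtain ⟨A⟩ := hM n _ hXs
  refine ⟨⟨A.ofIso e⟩, fun p c hc hpp ↦ ?_⟩
  have halg := mem_algebraicClasses_map_of_iso hXs hX e
    (hfib p (singularCohomology.map ℂ ℂ (AlgPoints.mapContinuous (L := ℂ) e.inv) (2 * p) c)
      (hc.map _) (hpp.map_of_iso e.symm))
  rwa [show complexBetti.map e.hom (2 * p)
      (singularCohomology.map ℂ ℂ (AlgPoints.mapContinuous (L := ℂ) e.inv) (2 * p) c) = c from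
    map_hom_map_inv_apply e (2 * p) c] at halg

/-- **`GenericityReduction` from the three named facts** `spreadingOut_smoothProjective_qbarFamily`,
`bku_finite_monodromyOrbit_of_isHodgeGenericIn`, `voisin2007_algebraic_of_finite_monodromyOrbit_of_qbar`:
the `ℚ̄`-genericity principle is the PROVED theorem
`IsDefinedOverQbar.eq_univ_of_closure_base_pt_eq_univ` of
`Literature/AlgebraicGeometry/HodgeTheory/QbarGenericPointsDense.lean` (conjugates of a complex point
over the generic point are Zariski dense — the relevant case of Lang's C4 ⇒ C7), a quasi-projective
`ℚ̄`-scheme being locally of finite type (`locallyOfFiniteType_of_isQuasiProjectiveOver`).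
[cite: Lang1958IAG, Ch. III §5, C4–C7] [cite: CharlesSchnell2014Notes, Thm. 11.3.19] -/
theorem genericityReduction_of_three_facts
    (hSp : Literature.AlgebraicGeometry.HodgeTheory.spreadingOut_smoothProjective_qbarFamily)
    (hB : Literature.AlgebraicGeometry.HodgeTheory.bku_finite_monodromyOrbit_of_isHodgeGenericIn)
    (hV : Literature.AlgebraicGeometry.HodgeTheory.voisin2007_algebraic_of_finite_monodromyOrbit_of_qbar) :
    Summit.HodgeConjecture.HodgeConjecture.Theses.PeriodDeficiency.GenericityReduction :=
  genericityReduction_of_qbarGeneric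
    (fun _σ S₀ hS₀ _s hs _Z hZ hsZ =>
      haveI : LocallyOfFiniteType S₀.hom := locallyOfFiniteType_of_isQuasiProjectiveOver hS₀
      hZ.eq_univ_of_closure_base_pt_eq_univ hsZ hs)
    hSp hB hV

end Summit.HodgeConjecture.HodgeConjecture.Theorems

end
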